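import Summits.ResolutionOfSingularities.ResolutionOfSingularities.Theorems.MaxContactCutWallCut
import Literature.AlgebraicGeometry.Resolution.PointBlowupIFPGiraud
import Literature.AlgebraicGeometry.Resolution.PointBlowupFlagTranslatedStep
import Mathlib.RingTheory.PowerSeries.Order
import Mathlib.RingTheory.PowerSeries.NoZeroDivisors
import Mathlib.Algebra.Order.BigOperators.Group.Finset
import HarnessLib

/-!
# NearCutForms — decomp-res node «NearCut» (lens-3 g22, critic row 170), tree file 1/10 of the node

Content VERBATIM from the decomp-res lens-3 g22 node `HOME/decomp-res-lens-3/g22/NearCut.lean` (pin 52e91527, 2239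
l; parts in `g22/parts/`, `assemble.sh`
byte-identical; HOME = run/shared/lean/pub/decomp-res).  Farm (node): rc 0 · 0 err · 0 sorry · axioms {propext,
Classical.choice, Quot.sound}; the node's three
deprecated `Finsupp.degree_add` rewrites (alias of `map_add`) are written `map_add` here (critic row 170 rider) —
the ONLY textual change besides the file split.
Critic: CRITIC-LEDGER row 170 (2026-08-31T02:36:14Z): «NearCut» BOOKED 0·0 (DECIDED 0 · MAP 0: the δ-balanced
wild/tame/boundary tails are decided as ONE class MODULO
one printed theorem — Cossart–Jannsen–Saito LNM 2270 Thm 5.40, `B = ∅`, typed as the hypothesis `NearChainPort` —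
and ONE named classical library target `BranchSelection`;
KERNEL-PROVED here: the forms, the directrix law, the companion law, the wall exclusion, the arc-shedding
monovariant, and every booking).  Landing orders INBOX :715
(lens-3 g22 landing note) endorsed with amendments by the critic INBOX :727: land the KERNEL sections now,
independent of lens-3's port choice, as
`Theorems/NearCutForms` (§N0+§N1) · `NearCutCompanion` (§N4a+§N4b) · `NearCutWalls` (§N5+§N5b+§N5c) · `NearCutArcs`
(§N5d) · `NearCutPort` (§N2: defs / pieces / skeleton —
`NearChainPort`, `SheddingLemma`, `BranchSelection` appear ONLY as hypotheses / defs, nothing asserted) ·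
`MaxContactCutNearCut` (§N3+§N3b; §M dropped), all `--kind proof
--supports stmt-ResolutionOfSingularities-31770`; files chained linearly in the lens's own order (each imports its
predecessor; numbered continuations where the
400-line cap cuts).  NO new aside (lens-3's live aside stays `NoSmallDeadStrictHighSkewJointTailsDeep`); the PORT
item `NearChainPort` is filed only after lens-3 confirms
the column's one port slot on the bus; `BranchSelection` / `ChainShedding` may become ONE prover target item under 31770.

The lens header, verbatim:

> # NearCut — THE COMPANION SURFACE: every δ-balanced tail (wild `p ∣ s`, tame `p ∤ s`, boundary `q + 1 = 2s`) carries a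
> # point-blowup chain of an ISOLATED-ORDER-`s` SURFACE GERM whose points stay NEAR (directrix a pure power, kernel) —
> # decided as ONE class modulo ONE printed theorem (Cossart–Jannsen–Saito, LNM 2270, Thm 5.40, `B = ∅`) and ONE named
> # classical LIBRARY target (curve selection / arc lifting along a point-blowup chain); the shedding of off-wall order-`s`
> # curves is PROVED here: its wall half from the threefold's forcedness, its monovariant half on formal arcs
> # (decomp-res lens-3 «one EQUIV + split beneath», g22)
>
> TARGET (critic row 158 / window g22, (a″)): `WallCut.NoWildBalancedStrictTailsDeep` (g21 §W4, `p ∣ s`) decided AS A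
> WHOLE by «ONE cn27 paper lemma for the wild case … a genuinely different printed law, typed honestly, not a widened
> port».  THE PRINTED LAW IS CHARACTERISTIC-FREE EMBEDDED SURFACE RESOLUTION BY POINT BLOWUPS AT NEAR POINTS (CJS 2020,
> Thm 5.40 with Thm 5.35 / Cor 5.37, boundary `B = ∅`), applied NOT to the threefold `x^q + F` but to its COMPANION
> SURFACE GERM `G_t := F_t / y^{r_t}` stripped of the `K[y^q]`-part — no Tschirnhaus, no `p ∤ s`, no jumping: the wild
> case is covered because the port never mentions `p`.  What makes the port HONEST (every hypothesis PROVED in kernel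
> from the walk, none assumed):
> * §N4 THE COMPANION LAW `companionLaw` (KERNEL, every cell): along a δ-balanced plateau (`|r_t| = 2δ`, two walls of
>   height `δ = q − s`, shade `s`, `o_t ≠ q`) the cleaned residual is `F_t = y^{r_t}·U_t·G_n + C_t` with `U_t(0) ≠ 0`,
>   `C_t ∈ K[y^q]`, where `G_{n+1} = translate_{b_t}(cT_s^{j_t} G_n)` IS THE POINT-BLOWUP CHAIN OF THE SURFACE `G_0 =
>   F_N / y^{r_N}` at the walk's own points, and `ord G_n = s` for EVER (NEAR) with `in_{|r|+s}(F_t) = U_t(0)·y^{r_t}·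
>   in_s(G_n)` (LAYER).  Mechanism: multiplicativity of the chart transform across levels `cT_q(y^rU·G) = cT_δ(y^rU)·
>   cT_s(G)` (`chartTransform_mul_of_le`), the boundary factor (`boundary_step`), `K[y^q]` is a subring stable under
>   chart transforms and translations in characteristic `p` and contains the cleaning correction (`isQPoly_*`), and the
>   TWO-WALL SEPARATION `not_qpow_on_two_walls`: no `q`-th power monomial sits on two walls of height `δ` below degree
>   `2s` — so a drop of `ord G` would exhibit such a monomial in `C_t` and a rise would make `in(F_t)` a `q`-th power
>   (`near_of_structure`).
> * §N1 THE DIRECTRIX LAW `directrix_of_plateau` (KERNEL): on a plateau with recurring proximity repeats the restricted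
>   cone form is a pure `n`-th power at EVERY stage (backward propagation of ConeCut's power law through the PROVED
>   re-homogenisation identity `eq_shear_of_isHomogeneous`), hence `in_s(G_n) = c·ℓ^s`: every point of the chain is NEAR /
>   directrix-near in the sense of CJS Def 5.38/5.39 with `e(x) = 1 … 2`.
> * §N2 THE ONE EQUIV `NearChainPort` = CJS Thm 5.40 (`B = ∅`) for the chain: no infinite point-blowup chain of a surface
>   germ in `𝔸³` with `ord = s ≥ 2` constant, pure-power initial forms, and ISOLATED order-`s` locus at every stage
>   (`IsolatedMult`, Hasse-derivative ideal of order `< s`).  Isolation is supplied from some stage on by the SHEDDING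
>   LEMMA `SheddingLemma`, which §N5 REDUCES IN KERNEL to its classical off-wall half:
> * §N5 WALL EXCLUSION `wallIsolation` (KERNEL): the threefold's forcedness `ForcedWalk.isolated` already confines the
>   order-`s` locus of `G_n` off BOTH walls at EVERY stage — `topIdeal q F_t ⊆ multIdeal s G_n + (y_w)`
>   (`topIdeal_le_multIdeal_sup_wall`: higher Leibniz rule, `D^β(y_w^δ) ∈ (y_w)` unless `β = δ·e_w`, and
>   `D^α K[y^q] = 0` for `0 < |α| < q`, `hasseDeriv_eq_zero_of_isQPoly`); hence `sheddingLemma_of_offWall :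
>   OffWallShedding → SheddingLemma` by ideal arithmetic (`isolatedMult_of_walls`), where `OffWallShedding` (NAMED PROVER
>   TARGET, the only non-kernel, non-printed piece; one-page paper proof in NODE-g22 §3: the monovariant
>   `Φ = Σ_walls i(γ·W)` sheds every off-wall order-`s` branch, new branches are born only inside the exceptional WALL) says
>   that for `n ≫ 0` the order-`s` locus of `G_n` lies in the union of the two walls.  §N5b `walls_succ` (KERNEL): under a
>   balanced move the chart slot becomes a wall and exactly one old wall is kept with zero translation; §N5c gives the
>   target its final WALK-FREE, characteristic-free form `ChainShedding` (a chain of point blow-ups of a surface in `𝔸³` of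
>   constant multiplicity `s` with two moving coordinate walls, exceptional plane always a wall, kept walls untranslated,
>   multiplicity-`s` locus off every wall ⟹ eventually isolated) with `sheddingLemma_of_chainShedding`,
>   `offWallShedding_of_chainShedding` PROVED.  §N5d PROVES THE MONOVARIANT: `arc_shedding` (KERNEL) — a compatible family
>   of formal arcs `γ⁽ⁿ⁾ ∈ (τL⟦τ⟧)³` through the centres cannot avoid the walls for ever (`Σ_walls ord(y_c∘γ⁽ⁿ⁾)` drops by
>   the multiplicity `ord(y_{j_n}∘γ⁽ⁿ⁾) ≥ 1` per step: exceptional wall `+m`, each kept wall `−m`, `wallSum_drop`); hence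
>   `chainShedding_of_branchSelection : BranchSelection → ChainShedding` (KERNEL; wall certificates evaluated along the
>   arcs), where `BranchSelection` is the residual LIBRARY TARGET (classical, field-theoretic, resolution-free): along a
>   point-blowup chain whose order-`s` loci are not isolated infinitely often (and meet the exceptional plane only at the
>   centre) some formal branch is followed for ever — decomposition into components, finiteness of branches, Cohen
>   structure of smooth curve germs, König.
> CONSEQUENCES (§N3/§N3b, KERNEL given the two named pieces): `noBalancedTails_of_port_offWall : NearChainPort →
> OffWallShedding → NoBalancedTailsDeep` (ALL δ-balanced tails, any `p`, `s ≥ 2`), whence `NoWildBalancedStrictTailsDeep`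
> (a″), `NoTameBalancedStrictTailsDeep` (g21's port class, now Tschirnhaus-free) AND `FreezeCut.NoBalancedBoundaryTailsDeep`
> (g20's port class) by binder dropping; EXACT host re-location `defectWalksDeep_iff_of_nearPort_offWall : NearChainPort →
> OffWallShedding → (MaxContactCut.DefectWalksDeep ↔ NoFreePointTailsDeep ∧ NoHighPlanarJointTailsDeep ∧
> NoLossyStrictTailsDeep)`, its walk-free twin `defectWalksDeep_iff_of_nearPort_chain : NearChainPort → ChainShedding →
> (…same…)` and the FINAL form `defectWalksDeep_iff_of_nearPort_branch : NearChainPort → BranchSelection → (…same…)`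
(reading R2: the near-chain port REPLACES `BalancedWallPort`/`KollarWallPort`, whose O1–O6 were
> never typed) and `defectWalksDeep_iff_of_both_ports` (reading R1: keep g21's port, use the near-chain port for the wild
> class only).  ENTRANCES (census T-balanced 0ebf9c7d): WILD (8,6) `2 ∣ 6`, `r = (2,0,2)`, H:1489/1490 and TAME (4,3)
> H:142…153 — NODE-g22 §4 / desk/companion.py run the companion chain on them exactly (NEAR, LAYER, structure, purity,
> isolation of the order-`s` locus at every plateau stage; the plateau is left exactly when `in_s(G_n)` stops being a pure
> power, and `ord G` then equals the new shade).
>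
> LAYOUT (rev 3, built on the tree of 2026-08-31T02:08Z: the writer has meanwhile LANDED g19 rev 4 §D/§K7
> (`FreezeCutDead*`, `MaxContactCutFreezeCutDead`), g20 §1–§3 (`ExtinctionCutToric*`, `ExtinctionCutPort`,
> `MaxContactCutExtinctionCut`) and ALL of g21 (`WallLaw`, `WallLaw2`, `PollutionLaw`, `WallCutClasses`,
> `MaxContactCutWallCut` = p800230) — all IMPORTED through `Theorems.MaxContactCutWallCut`; NOTHING is carried; every
> declaration below is new in g22).  opens = tree `MaxContactCutFreezeCut.lean` l. 43–61 · §N0 forms (dehomogenisation / face /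
> shear / re-homogenisation) · §N1 directrix law · §N2 the ONE EQUIV + the companion chain + the named pieces + composition ·
> §N4a `K[y^q]`, multiplicativity, boundary factor, lowest layer, two-wall separation · §N4b NEAR, LAYER, the structure
> invariant, `companionLaw` · §N5 wall exclusion, `OffWallShedding`, `sheddingLemma_of_offWall` · §N5b `walls_succ` · §N5c
> `ChainShedding` + reductions · §N5d `arc_shedding`, `BranchSelection`, `chainShedding_of_branchSelection` · §N3/§N3b
> booking · §M `closes` VERBATIM.  IMPORTS: tree only (`MaxContactCutWallCut`; two Literature modules: `PointBlowupIFPGiraud`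
> for `X_pow_mul_chartTransform`, `PointBlowupFlagTranslatedStep` for `chartTransform_add / chartTransform_monomial`; three
> Mathlib modules for `PowerSeries.order`).  0 `sorry`, 0 new axioms.

## This file

§N0 FORMS (generic algebra, PROVED: dehomogenisation `y_j := 1`, the `y_j`-free face, the shear, re-homogenisation — `section Forms`) and §N1 THE DIRECTRIX LAW ALONG A WALK (kernel, PROVED, hypothesis-free, every `(q, n)` — `section Walks`).  (This first part carries: `dehom`, `face`, `shear`, `translate_eq_aeval`, `aeval_aeval'`, `dehom_monomial`, `face_monomial`, `coeff_face`, `eq_of_update_eq`, `degree_eq_of_mem_support_of_isHomogeneous`, `coeff_dehom_of_isHomogeneous`, `isHomogeneous_shear`, `aeval_pure`.)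

[WRITER NOTE (decomp-res writer g10): file split only (tree files ≤ 400 lines); namespace blocks, sections, section
variables, `open` lines and every declaration
exactly as in the lens; the three deprecated `Finsupp.degree_add` occurrences read `map_add` (definitionally the same lemma).]

(Sources: cossart2020 (Cossart–Jannsen–Saito LNM 2270: Thm 5.40 p. 85, Defs 5.38/5.39 pp. 84–85, Thm 5.28 p. 72, Thm
5.35 / Cor 5.37); HauserPerlega2024 (Prop. 3 p. 791); Hauser2010Kangaroo (arXiv:0811.4151); Moh1987;
CossartPiltant2008 §2; Giraud1975; Hironaka1964.)
-/

noncomputable section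

open MvPolynomial Finset
open Literature.AlgebraicGeometry.Resolution
open Literature.AlgebraicGeometry.Resolution.Hauser2010
open Literature.AlgebraicGeometry.Resolution.PointBlowup
open Summit.ResolutionOfSingularities.ResolutionOfSingularities.Theses
open Summit.ResolutionOfSingularities.ResolutionOfSingularities.Theorems.TightDefectClasses
open Summit.ResolutionOfSingularities.ResolutionOfSingularities.Theorems.TightDefectStrongWalks
open Summit.ResolutionOfSingularities.ResolutionOfSingularities.Theorems.ItineraryCutClasses
open Summit.ResolutionOfSingularities.ResolutionOfSingularities.Theorems.BoundaryLedger
open Summit.ResolutionOfSingularities.ResolutionOfSingularities.Theorems.ProximityCut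
open Summit.ResolutionOfSingularities.ResolutionOfSingularities.Theorems.ConeCutAxisLaw
open Literature.AlgebraicGeometry.Resolution.WeightedBlowup
open Literature.Barriers.ResolutionOfSingularities
open Summit.ResolutionOfSingularities.ResolutionOfSingularities.Theorems.FloorCut
open Summit.ResolutionOfSingularities.ResolutionOfSingularities.Theorems.ConeCut
open Summit.ResolutionOfSingularities.ResolutionOfSingularities.Theorems.ExitLaw (fin3_cases eq_of_le_of_degree_le)
open Summit.ResolutionOfSingularities.ResolutionOfSingularities.Theorems.ShadeCut
open Summit.ResolutionOfSingularities.ResolutionOfSingularities.Theorems.TightCut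
open Summit.ResolutionOfSingularities.ResolutionOfSingularities.Theorems.HoleCut

namespace Summit.ResolutionOfSingularities.ResolutionOfSingularities.Theorems.NearCut

section Forms

variable {σ : Type*} {K : Type*} [Field K] [DecidableEq σ]

/-! ## §N0 FORMS (generic algebra, PROVED): dehomogenisation `y_j := 1`, the `y_j`-free face `y_j := 0`, the shear
`y_i ↦ y_i − β_i y_j` (the homogenisation of the translation by `β`), and the RE-HOMOGENISATION LEMMA: a form `R` of
degree `n` is recovered from its translated dehomogenisation `N = translate β (R|_{y_j := 1})` as `R = shear β N`,
provided `N` is again a form of degree `n` (which is what the tree's CONE LAW asserts for the residual cone). -/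

/-- Dehomogenisation at `y_j`: `P(y_j := 1)`. DEFINITION (support). -/
def dehom (j : σ) (P : MvPolynomial σ K) : MvPolynomial σ K :=
  aeval (Function.update X j 1) P

/-- The `y_j`-free face: `P(y_j := 0)`. DEFINITION (support). -/
def face (j : σ) (P : MvPolynomial σ K) : MvPolynomial σ K :=
  aeval (Function.update X j 0) P

/-- The shear `y_i ↦ y_i − β_i · y_j` (with `β_j = 0` it fixes `y_j`): homogenisation of `translate β`.
DEFINITION (support). -/
def shear (j : σ) (β : σ → K) (P : MvPolynomial σ K) : MvPolynomial σ K :=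
  aeval (fun i => X i - C (β i) * X j) P

omit [DecidableEq σ] in
/-- `translate_eq_aeval`: Auxiliary step of this node's calculus, VERBATIM from the lens file (see the module
docstring); the statement is its type. [folklore] -/
theorem translate_eq_aeval (b : σ → K) (P : MvPolynomial σ K) :
    translate b P = aeval (fun i => X i + C (b i)) P := rfl

omit [DecidableEq σ] in
/-- Composition of substitutions. [folklore] -/
theorem aeval_aeval' (f g : σ → MvPolynomial σ K) (P : MvPolynomial σ K) :
    aeval f (aeval g P) = aeval (fun i => aeval f (g i)) P := by
  rw [← AlgHom.comp_apply, comp_aeval]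

/-- `y_j := 1` on a monomial deletes the `y_j`-exponent. [folklore] -/
theorem dehom_monomial (j : σ) (d : σ →₀ ℕ) (c : K) :
    dehom j (monomial d c) = monomial (d.update j 0) c := by
  classical
  unfold dehom
  rw [aeval_monomial, algebraMap_eq, monomial_eq, Finsupp.prod, Finsupp.prod, Finsupp.support_update_zero]
  congr 1
  by_cases hj : j ∈ d.support
  · rw [← Finset.mul_prod_erase d.support _ hj, Function.update_self, one_pow, one_mul]
    refine Finset.prod_congr rfl fun i hi => ?_
    have hij : i ≠ j := Finset.ne_of_mem_erase hi
    rw [Function.update_of_ne hij, Finsupp.update_apply, if_neg hij]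
  · rw [Finset.erase_eq_of_notMem hj]
    refine Finset.prod_congr rfl fun i hi => ?_
    have hij : i ≠ j := fun h => hj (h ▸ hi)
    rw [Function.update_of_ne hij, Finsupp.update_apply, if_neg hij]

/-- `y_j := 0` on a monomial: kills it iff `y_j` occurs. [folklore] -/
theorem face_monomial (j : σ) (d : σ →₀ ℕ) (c : K) :
    face j (monomial d c) = if d j = 0 then monomial d c else 0 := by
  classical
  unfold face
  rw [aeval_monomial, algebraMap_eq]
  split_ifs with hdj
  · rw [monomial_eq, Finsupp.prod, Finsupp.prod]
    congr 1
    refine Finset.prod_congr rfl fun i hi => ?_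
    have hij : i ≠ j := fun h => (Finsupp.mem_support_iff.mp hi) (h ▸ hdj)
    rw [Function.update_of_ne hij]
  · have hj : j ∈ d.support := Finsupp.mem_support_iff.mpr hdj
    rw [Finsupp.prod, ← Finset.mul_prod_erase d.support _ hj, Function.update_self, zero_pow hdj, zero_mul,
      mul_zero]

/-- Coefficients of the face. [folklore] -/
theorem coeff_face (j : σ) (P : MvPolynomial σ K) (m : σ →₀ ℕ) :
    coeff m (face j P) = if m j = 0 then coeff m P else 0 := by
  classical
  have hP : face j P = ∑ d ∈ P.support, face j (monomial d (coeff d P)) := by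
    conv_lhs => rw [P.as_sum]
    unfold face
    rw [map_sum]
  rw [hP, coeff_sum]
  simp_rw [face_monomial]
  split_ifs with hm
  · rw [Finset.sum_eq_single m]
    · rw [if_pos hm, coeff_monomial, if_pos rfl]
    · intro d _ hdm
      split_ifs
      · rw [coeff_monomial, if_neg hdm]
      · rfl
    · intro hm'
      rw [if_pos hm, coeff_monomial, if_pos rfl]
      exact MvPolynomial.notMem_support_iff.mp hm'
  · refine Finset.sum_eq_zero fun d _ => ?_
    split_ifs with hd
    · rw [coeff_monomial, if_neg]
      rintro rfl
      exact hm hd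
    · rfl

omit [DecidableEq σ] in
/-- Two exponents of the same degree that agree off `j` are equal. [folklore] -/
theorem eq_of_update_eq [Fintype σ] {j : σ} {d d' : σ →₀ ℕ} (hdeg : d'.degree = d.degree)
    (heq : d'.update j 0 = d.update j 0) : d' = d := by
  classical
  have h1 : ∀ k, k ≠ j → d' k = d k := by
    intro k hk
    have := DFunLike.congr_fun heq k
    rwa [Finsupp.update_apply, Finsupp.update_apply, if_neg hk, if_neg hk] at this
  ext k
  by_cases hk : k = j
  · subst hk
    have e1 := PointBlowup.degree_eq_add_sum_erase k d
    have e2 := PointBlowup.degree_eq_add_sum_erase k d'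
    have e3 : ∑ i ∈ Finset.univ.erase k, d' i = ∑ i ∈ Finset.univ.erase k, d i :=
      Finset.sum_congr rfl fun i hi => h1 i (Finset.ne_of_mem_erase hi)
    omega
  · exact h1 k hk

omit [DecidableEq σ] in
/-- Exponents in the support of a form of degree `n` have degree `n`. [folklore] -/
theorem degree_eq_of_mem_support_of_isHomogeneous {R : MvPolynomial σ K} {n : ℕ} (hR : R.IsHomogeneous n)
    {e : σ →₀ ℕ} (he : e ∈ R.support) : e.degree = n := by
  have := hR (MvPolynomial.mem_support_iff.mp he)
  rw [Finsupp.degree_eq_weight_one]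
  exact this

/-- Coefficients of the dehomogenisation OF A FORM: `coeff_{d[j↦0]} (R|_{y_j:=1}) = coeff_d R` for `|d| = n`.
[folklore] -/
theorem coeff_dehom_of_isHomogeneous [Fintype σ] (j : σ) {R : MvPolynomial σ K} {n : ℕ} (hR : R.IsHomogeneous n)
    (d : σ →₀ ℕ) (hd : d.degree = n) : coeff (d.update j 0) (dehom j R) = coeff d R := by
  classical
  have hP : dehom j R = ∑ e ∈ R.support, monomial (e.update j 0) (coeff e R) := by
    conv_lhs => rw [R.as_sum]
    unfold dehom
    rw [map_sum]
    exact Finset.sum_congr rfl fun e _ => dehom_monomial j e (coeff e R)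
  rw [hP, coeff_sum, Finset.sum_eq_single d]
  · rw [coeff_monomial, if_pos rfl]
  · intro e he hed
    rw [coeff_monomial, if_neg]
    intro heq
    apply hed
    exact eq_of_update_eq ((degree_eq_of_mem_support_of_isHomogeneous hR he).trans hd.symm) heq
  · intro hd'
    rw [coeff_monomial, if_pos rfl]
    exact MvPolynomial.notMem_support_iff.mp hd'

omit [DecidableEq σ] in
/-- A shear maps forms to forms of the same degree. [folklore] -/
theorem isHomogeneous_shear (j : σ) (β : σ → K) {N : MvPolynomial σ K} {n : ℕ} (hN : N.IsHomogeneous n) :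
    (shear j β N).IsHomogeneous n := by
  have h := hN.aeval (fun i => X i - C (β i) * X j)
    (fun i => (isHomogeneous_X K i).sub (isHomogeneous_C_mul_X (β i) j))
  rwa [one_mul] at h

omit [DecidableEq σ] in
/-- A substitution by linear forms maps a pure power of a linear form to a pure power of a linear form. [folklore] -/
theorem aeval_pure (g : σ → MvPolynomial σ K) (hg : ∀ i, (g i).IsHomogeneous 1) {c : K}
    {L : MvPolynomial σ K} (hL : L.IsHomogeneous 1) (n : ℕ) :
    ∃ L' : MvPolynomial σ K, L'.IsHomogeneous 1 ∧ aeval g (C c * L ^ n) = C c * L' ^ n := by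
  refine ⟨aeval g L, ?_, ?_⟩
  · have h := hL.aeval g hg
    rwa [one_mul] at h
  · rw [map_mul, map_pow, aeval_C, algebraMap_eq]

end Forms

end Summit.ResolutionOfSingularities.ResolutionOfSingularities.Theorems.NearCut
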